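import Literature.RepresentationTheory.HeisenbergGroup.MpPsiIntertwinerCongr
import Literature.RepresentationTheory.HeisenbergGroup.SchrodingerSymplecticGenerators
import Literature.RepresentationTheory.HeisenbergGroup.SchrodingerModel
import Mathlib.Tactic.LinearCombination
import Mathlib.Tactic.Ring
import HarnessLib

/-!
# The Schrödinger model only sees the square class of its central character: `ψ(s²·)` versus `ψ`

Topic `RepresentationTheory/HeisenbergGroup`; namespace `Literature.RepresentationTheory.HeisenbergGroup`.
KERNEL mathematics only (theorems; no definition, no named fact, no `sorry`).

Let `β : X × Y → R` be a pairing, `ψ` an additive character of `R` and `s ∈ Rˣ`.  The dilation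
`d_s : (v, t) ↦ (s•v, s²t)` is an automorphism of Weil's Heisenberg group `Heisenberg (polar β)`
(`polar β` is bilinear, so `polar β (s•v) (s•v') = s² · polar β v v'`), it commutes with the action of every
symplectic `g` through Weil's section `ofSymplectic` (the corrections `f_g(w) = ½(B(gw,gw) - B(w,w))` are
quadratic), and the Schrödinger models for the characters `ψ(s² ·) = ψ.mulShift (s*s)` and `ψ` are
intertwined ALONG `d_s` by the dilation operator `D_s : f ↦ f(s⁻¹ ·)` of `𝒮(X)` (the tree's Levi operator
`leviEquivSB (LinearEquiv.smulOfUnit s) (continuous_const_smul (s : R)) (continuous_const_smul ((s⁻¹ : Rˣ) : R))`,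
without modulus factor; any other continuity proofs give the same operator by proof irrelevance):

  `D_s (ρ_{β, ψ(s²·)}(h) f) = ρ_{β, ψ}(d_s h) (D_s f)`        (`leviEquivSB_schrodingerSB_mulShift_sq`).

Consequently (the tree's functoriality `MpPsi.congr` of MVW's group of pairs `S̃p_ψ = MpPsi ρ` along
`(Φ, T, φ) = (d_s, D_s, id)`):

* `exists_mpPsi_equiv_mulShift_sq`: there is a group isomorphism
  `MpPsi (schrodingerSB β (ψ.mulShift (s*s)) …) ≃* MpPsi (schrodingerSB β ψ …)`, `(g, M) ↦ (g, D_s M D_s⁻¹)`,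
  lying over the IDENTITY of `Sp(𝕎)` and under which the two tautological (Weil) representations are
  intertwined by `D_s`;
* `exists_section_mulShift_sq` / `exists_section_of_mulShift_sq`: every homomorphism (section)
  `σ : G →* S̃p_{ψ(s²·)}` over a map `ι : G → Sp(𝕎)` yields a section `G →* S̃p_ψ` over the SAME `ι` whose Weil
  representation is `D_s ∘ ω_σ ∘ D_s⁻¹`, and conversely.

So the smooth Weil/oscillator packages attached to `ψ` and to `ψ(a·)` agree as soon as `a` is a SQUARE unit —
the classical statement that the isomorphism class of the Weil representation `ω_ψ` depends on `ψ` only through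
its class modulo `(R^×)²` (for `a = s²` the dilation by `s` realises the isomorphism; [MoeglinVignerasWaldspurger1987]
Chap. 2, II.1 and Remarque (3): `GSp(W)` acts on `H` and on `S̃p_ψ(W)`, the similitude of ratio `a` carrying
`ψ` to `ψ^a`; [Kudla1994] §1 / [Rangarao1993] §3 for the `F`-points statement).  This is the "square-class"
half of the dictionary `ψ_v(κ·) ↔ ⟨κ⟩`-scaling used for the Galois twist of local theta packages; the other half
(rescaling the CENTRE, `ψ(a·)` on `H(B)` versus `ψ` on `H(a•B)`) is the companion file
`SchrodingerAddCharRescaling`.  Nothing here uses a topology on `R` beyond local constancy of the characters, nor a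
measure; `R` is any commutative ring with `2` invertible, `X` any topological `R`-module with continuous scalar
multiplication.
-/

set_option autoImplicit false

noncomputable section

namespace Literature.RepresentationTheory.HeisenbergGroup

open Literature.NumberTheory.Automorphic (SchwartzBruhat)

universe u v w

section DilationOperator

variable {R : Type u} [CommRing R] {X : Type v} [AddCommGroup X] [Module R X] [TopologicalSpace X]
  [ContinuousConstSMul R X] (s : Rˣ)

/-- the dilation operator `D_s = leviEquivSB (s • 1)` acts by `(D_s f)(u) = f (s⁻¹ • u)`.
[cite: Weil1964, n° 13, p. 160] -/
theorem coe_leviEquivSB_smulOfUnit_apply (f : SchwartzBruhat X) (u : X) :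
    ((leviEquivSB (LinearEquiv.smulOfUnit s : X ≃ₗ[R] X) (continuous_const_smul (s : R))
        (continuous_const_smul ((s⁻¹ : Rˣ) : R)) f : SchwartzBruhat X) : X → ℂ) u =
      (f : X → ℂ) (((s⁻¹ : Rˣ) : R) • u) := by
  rw [coe_leviEquivSB, leviOp_apply]
  rfl

end DilationOperator

variable {R : Type u} [CommRing R] [Invertible (2 : R)] {X : Type v} {Y : Type w} [AddCommGroup X] [Module R X]
  [AddCommGroup Y] [Module R Y] (β : X →ₗ[R] Y →ₗ[R] R) (ψ : AddChar R Circle)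
  [TopologicalSpace X] [TopologicalSpace R] [IsTopologicalAddGroup X] [ContinuousConstSMul R X]
  (hψ : IsLocallyConstant (⇑ψ : R → Circle)) (hβ : ∀ y : Y, Continuous fun u : X => β u y) (s : Rˣ)
  (hψs : IsLocallyConstant (⇑(ψ.mulShift ((s : R) * s)) : R → Circle))

/-! ## §1 The dilation `d_s` of the Heisenberg group and the operator `D_s` -/

omit [Invertible (2 : R)] in
/-- **the dilation intertwines the two Schrödinger models along `d_s`**: for `h = ((x, y), t)`,
`D_s (ρ_{β,ψ(s²·)}(h) f) = ρ_{β,ψ}((s x, s y), s² t) (D_s f)` — both sides are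
`u ↦ ψ(s²t + s·β(u, y)) f(s⁻¹u + x)`. [cite: MoeglinVignerasWaldspurger1987, Chap. 2 II Remarque (3)] -/
theorem leviEquivSB_schrodingerSB_mulShift_sq (h : Heisenberg (polar β)) (f : SchwartzBruhat X) :
    leviEquivSB (LinearEquiv.smulOfUnit s : X ≃ₗ[R] X) (continuous_const_smul (s : R)) (continuous_const_smul ((s⁻¹ : Rˣ) : R))
        (schrodingerSB β (ψ.mulShift ((s : R) * s)) hψs hβ h f) =
      schrodingerSB β ψ hψ hβ ⟨(s : R) • h.v, (s : R) * s * h.t⟩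
        (leviEquivSB (LinearEquiv.smulOfUnit s : X ≃ₗ[R] X) (continuous_const_smul (s : R))
          (continuous_const_smul ((s⁻¹ : Rˣ) : R)) f) := by
  apply Subtype.ext
  funext u
  rw [coe_leviEquivSB_smulOfUnit_apply, schrodingerSB_apply, schrodingerSB_apply,
    coe_leviEquivSB_smulOfUnit_apply, AddChar.mulShift_apply]
  have hmi : (s : R) * ((s⁻¹ : Rˣ) : R) = 1 := Units.mul_inv s
  have e1 : (s : R) * s * (h.t + β (((s⁻¹ : Rˣ) : R) • u) h.v.2) = (s : R) * s * h.t + β u (((s : R) • h.v).2) := by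
    simp only [Prod.smul_snd, map_smul, LinearMap.smul_apply, smul_eq_mul]
    linear_combination ((s : R) * β u h.v.2) * hmi
  have e2 : ((s⁻¹ : Rˣ) : R) • u + h.v.1 = ((s⁻¹ : Rˣ) : R) • (u + ((s : R) • h.v).1) := by
    rw [Prod.smul_fst, smul_add, smul_smul, Units.inv_mul, one_smul]
  rw [e1, e2]

/-! ## §2 `S̃p_{ψ(s²·)} ≃ S̃p_ψ` over the identity, intertwined by `D_s` -/

/-- **square classes of the central character**: there is a group isomorphism
`e : MpPsi (ρ_{β,ψ(s²·)}) ≃* MpPsi (ρ_{β,ψ})` of MVW's groups of pairs which (i) lies over the identity of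
`Sp(𝕎)` and (ii) intertwines the tautological Weil representations through the dilation `D_s`:
`ω(e p) (D_s f) = D_s (ω(p) f)`.  It is `MpPsi.congr` along `(d_s, D_s, id)`, i.e. `(g, M) ↦ (g, D_s M D_s⁻¹)`.
[cite: MoeglinVignerasWaldspurger1987, Chap. 2 II.1 (A)–(B) and Remarque (3)] -/
theorem exists_mpPsi_equiv_mulShift_sq :
    ∃ e : MpPsi (schrodingerSB β (ψ.mulShift ((s : R) * s)) hψs hβ) ≃* MpPsi (schrodingerSB β ψ hψ hβ),
      (∀ p, MpPsi.proj _ (e p) = MpPsi.proj _ p) ∧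
      ∀ p (f : SchwartzBruhat X),
        MpPsi.toRep _ (e p)
            (leviEquivSB (LinearEquiv.smulOfUnit s : X ≃ₗ[R] X) (continuous_const_smul (s : R))
              (continuous_const_smul ((s⁻¹ : Rˣ) : R)) f) =
          leviEquivSB (LinearEquiv.smulOfUnit s : X ≃ₗ[R] X) (continuous_const_smul (s : R))
            (continuous_const_smul ((s⁻¹ : Rˣ) : R)) (MpPsi.toRep _ p f) := by
  -- the dilation `d_s` of the Heisenberg group
  have hmi : (s : R) * ((s⁻¹ : Rˣ) : R) = 1 := Units.mul_inv s
  let Φ : Heisenberg (polar β) ≃* Heisenberg (polar β) :=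
    { toFun := fun h => ⟨(s : R) • h.v, (s : R) * s * h.t⟩
      invFun := fun h => ⟨((s⁻¹ : Rˣ) : R) • h.v, ((s⁻¹ : Rˣ) : R) * (s⁻¹ : Rˣ) * h.t⟩
      left_inv := fun h => by
        refine Heisenberg.ext ?_ ?_
        · show ((s⁻¹ : Rˣ) : R) • (s : R) • h.v = h.v
          rw [smul_smul, Units.inv_mul, one_smul]
        · show ((s⁻¹ : Rˣ) : R) * (s⁻¹ : Rˣ) * ((s : R) * s * h.t) = h.t
          linear_combination (((s : R) * ((s⁻¹ : Rˣ) : R) + 1) * h.t) * hmi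
      right_inv := fun h => by
        refine Heisenberg.ext ?_ ?_
        · show (s : R) • ((s⁻¹ : Rˣ) : R) • h.v = h.v
          rw [smul_smul, Units.mul_inv, one_smul]
        · show (s : R) * s * (((s⁻¹ : Rˣ) : R) * (s⁻¹ : Rˣ) * h.t) = h.t
          linear_combination (((s : R) * ((s⁻¹ : Rˣ) : R) + 1) * h.t) * hmi
      map_mul' := fun a b => by
        refine Heisenberg.ext ?_ ?_
        · show (s : R) • (a * b).v = (s : R) • a.v + (s : R) • b.v
          rw [Heisenberg.mul_v, smul_add]
        · show (s : R) * s * (a * b).t =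
            (s : R) * s * a.t + (s : R) * s * b.t + polar β ((s : R) • a.v) ((s : R) • b.v)
          simp only [Heisenberg.mul_t, map_smul, LinearMap.smul_apply, smul_eq_mul]
          ring }
  have hΦ : ∀ h : Heisenberg (polar β), Φ h = ⟨(s : R) • h.v, (s : R) * s * h.t⟩ := fun _ => rfl
  have hT : ∀ (h : Heisenberg (polar β)) (f : SchwartzBruhat X),
      leviEquivSB (LinearEquiv.smulOfUnit s : X ≃ₗ[R] X) (continuous_const_smul (s : R)) (continuous_const_smul ((s⁻¹ : Rˣ) : R))
          (schrodingerSB β (ψ.mulShift ((s : R) * s)) hψs hβ h f) =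
        schrodingerSB β ψ hψ hβ (Φ h)
          (leviEquivSB (LinearEquiv.smulOfUnit s : X ≃ₗ[R] X) (continuous_const_smul (s : R))
            (continuous_const_smul ((s⁻¹ : Rˣ) : R)) f) := fun h f => by
    rw [hΦ]
    exact leviEquivSB_schrodingerSB_mulShift_sq β ψ hψ hβ s hψs h f
  have hφ : ∀ (g : symplecticGroup (polar β)) (h : Heisenberg (polar β)),
      Φ ((ofSymplectic (polar β) g).act h) =
        (ofSymplectic (polar β) ((MulEquiv.refl (symplecticGroup (polar β))) g)).act (Φ h) := fun g h => by
    rw [hΦ, hΦ, MulEquiv.refl_apply]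
    refine Heisenberg.ext ?_ ?_
    · show (s : R) • ((ofSymplectic (polar β) g).act h).v = ((ofSymplectic (polar β) g).σ) ((s : R) • h.v)
      rw [Heisenberg.PseudoSymplectic.act_v, map_smul]
    · show (s : R) * s * ((ofSymplectic (polar β) g).act h).t =
        (s : R) * s * h.t + (ofSymplectic (polar β) g).f ((s : R) • h.v)
      simp only [Heisenberg.PseudoSymplectic.act_t, ofSymplectic_f, map_smul, LinearMap.smul_apply, smul_eq_mul]
      ring
  refine ⟨MpPsi.congr _ _ hT hφ, fun p => ?_, fun p f => ?_⟩
  · rw [MpPsi.proj_congr, MulEquiv.refl_apply]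
  · exact MpPsi.toRep_congr_apply _ _ hT hφ p f

/-! ## §3 Sections: transport over the same map to `Sp(𝕎)` -/

variable {G : Type*} [Group G]

/-- **sections transport, `ψ(s²·) ⇒ ψ`**: a homomorphism `σ : G →* S̃p_{ψ(s²·)}` gives a homomorphism
`σ' : G →* S̃p_ψ` over the same map to `Sp(𝕎)` (`proj ∘ σ' = proj ∘ σ`) whose Weil representation is conjugate
to that of `σ` by the dilation: `ω_{σ'}(g) (D_s f) = D_s (ω_σ(g) f)`.
[cite: MoeglinVignerasWaldspurger1987, Chap. 2 II.1 (B) and Remarque (3)] -/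
theorem exists_section_mulShift_sq (σ : G →* MpPsi (schrodingerSB β (ψ.mulShift ((s : R) * s)) hψs hβ)) :
    ∃ σ' : G →* MpPsi (schrodingerSB β ψ hψ hβ),
      (∀ g, MpPsi.proj _ (σ' g) = MpPsi.proj _ (σ g)) ∧
      ∀ g (f : SchwartzBruhat X),
        MpPsi.toRep _ (σ' g)
            (leviEquivSB (LinearEquiv.smulOfUnit s : X ≃ₗ[R] X) (continuous_const_smul (s : R))
              (continuous_const_smul ((s⁻¹ : Rˣ) : R)) f) =
          leviEquivSB (LinearEquiv.smulOfUnit s : X ≃ₗ[R] X) (continuous_const_smul (s : R))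
            (continuous_const_smul ((s⁻¹ : Rˣ) : R)) (MpPsi.toRep _ (σ g) f) := by
  obtain ⟨e, he, he'⟩ := exists_mpPsi_equiv_mulShift_sq β ψ hψ hβ s hψs
  exact ⟨e.toMonoidHom.comp σ, fun g => he (σ g), fun g f => he' (σ g) f⟩

/-- **sections transport, `ψ ⇒ ψ(s²·)`**: conversely a homomorphism `σ' : G →* S̃p_ψ` gives `σ : G →* S̃p_{ψ(s²·)}`
over the same map to `Sp(𝕎)` with `ω_{σ'}(g) (D_s f) = D_s (ω_σ(g) f)`.
[cite: MoeglinVignerasWaldspurger1987, Chap. 2 II.1 (B) and Remarque (3)] -/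
theorem exists_section_of_mulShift_sq (σ' : G →* MpPsi (schrodingerSB β ψ hψ hβ)) :
    ∃ σ : G →* MpPsi (schrodingerSB β (ψ.mulShift ((s : R) * s)) hψs hβ),
      (∀ g, MpPsi.proj _ (σ' g) = MpPsi.proj _ (σ g)) ∧
      ∀ g (f : SchwartzBruhat X),
        MpPsi.toRep _ (σ' g)
            (leviEquivSB (LinearEquiv.smulOfUnit s : X ≃ₗ[R] X) (continuous_const_smul (s : R))
              (continuous_const_smul ((s⁻¹ : Rˣ) : R)) f) =
          leviEquivSB (LinearEquiv.smulOfUnit s : X ≃ₗ[R] X) (continuous_const_smul (s : R))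
            (continuous_const_smul ((s⁻¹ : Rˣ) : R)) (MpPsi.toRep _ (σ g) f) := by
  obtain ⟨e, he, he'⟩ := exists_mpPsi_equiv_mulShift_sq β ψ hψ hβ s hψs
  refine ⟨e.symm.toMonoidHom.comp σ', fun g => ?_, fun g f => ?_⟩
  · have := he (e.symm (σ' g))
    rw [MulEquiv.apply_symm_apply] at this
    exact this
  · have := he' (e.symm (σ' g)) f
    rw [MulEquiv.apply_symm_apply] at this
    exact this

end Literature.RepresentationTheory.HeisenbergGroup

end
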